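import Mathlib
import Literature.MathematicalPhysics.KineticTheory.ZeroWavenumberSpace
import Literature.Barriers.AtomisticToContinuum.MazurBoundBallistic
import HarnessLib

/-!
# Stub S2a `stub_atomEqDrudeWeightOfContinuous` of line `SpectralTrichotomy`, crux `EmbeddedDrudeMourre.GreenKuboContinuation`
# (item stmt-AtomisticToContinuum-12597) = `Cruxes.NoDrudeWeight.Birth.stub_atomEqDrudeWeight` (stmt-14012 birth stub 2)
# with the strong continuity of the Koopman group as an added hypothesis.

Wiener's lemma for the atom at `0` (`τ⁻¹ ∫₀^τ ∫ cos(ωt) dσ dt = ∫ sinc(ωτ) dσ → σ{0}`) + von Neumann / Suzuki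
mean ergodic theorem (`Literature.Barriers.AtomisticToContinuum.Mazur.tendsto_inv_mul_integral_inner`) for the
strongly continuous orthogonal Koopman group `U_t` of `ℋ₀`: `τ⁻¹ ∫₀^τ ⟪U_t ψ, ψ⟫ → ‖P_{𝒬₀} ψ‖² = 𝖣_ψ`.

Structure of the file:
* `tendsto_inv_mul_integral_integral_cos` — Wiener's lemma in Cesàro form for a finite measure `σ` on `ℝ`:
  `τ⁻¹ ∫₀^τ (∫ cos(ωt) dσ(ω)) dt → σ{0}` (Fubini + dominated convergence, kernel `τ⁻¹ ∫₀^τ cos(ωt) dt`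
  bounded by `1` and tending to `𝟙_{ω = 0}`).
* `measureReal_zero_eq_norm_starProjection_sq` — for a strongly continuous contraction semigroup `U` on a
  real Hilbert space and a vector `x` whose autocorrelation `⟪x, U_t x⟫` is the cosine transform of `σ`,
  `σ{0} = ‖P_{Fix U} x‖²` (Wiener + `Mazur.tendsto_inv_mul_integral_inner` + uniqueness of limits).
* `isContractionSemigroup_koopmanCLM`, `invariantSubspace_koopmanCLM` — the Koopman group of a
  `FluctuationDynamics` is such a semigroup, with conserved vectors `𝒬₀ = conservedSpace`.
* `measureReal_zero_eq_drudeWeight` — the statement for a general `FluctuationDynamics`, and the stub.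
-/

noncomputable section

namespace Summit.AtomisticToContinuum.FouriersLaw.Theorems.GreenKuboContinuation.SpectralTrichotomy

open Filter Topology MeasureTheory Set
open scoped InnerProductSpace ENNReal
open Literature.MathematicalPhysics.KineticTheory.HeatConduction

/-! ## Wiener's lemma for the atom at `0`, Cesàro form -/

/-- Fubini for the bounded continuous integrand `cos(ωt)` on `[0, τ] × (ℝ, σ)`, `σ` finite:
`∫₀^τ ∫ cos(ωt) dσ(ω) dt = ∫ (∫₀^τ cos(ωt) dt) dσ(ω)`. [folklore] -/
theorem intervalIntegral_integral_cos_mul_swap (σ : Measure ℝ) [IsFiniteMeasure σ] (τ : ℝ) :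
    ∫ t in (0 : ℝ)..τ, ∫ ω, Real.cos (ω * t) ∂σ = ∫ ω, (∫ t in (0 : ℝ)..τ, Real.cos (ω * t)) ∂σ := by
  refine intervalIntegral_integral_swap ?_
  haveI : IsFiniteMeasure (volume.restrict (Set.uIoc (0 : ℝ) τ)) :=
    isFiniteMeasure_restrict.2 measure_Ioc_lt_top.ne
  refine (integrable_const (1 : ℝ)).mono' ?_ (Eventually.of_forall fun p => ?_)
  · exact (Real.continuous_cos.comp (continuous_snd.mul continuous_fst)).aestronglyMeasurable
  · simpa [Function.uncurry] using Real.abs_cos_le_one (p.2 * p.1)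

/-- `∫₀^τ cos(ωt) dt = sin(ωτ)/ω` for `ω ≠ 0`. [folklore] -/
theorem intervalIntegral_cos_mul_of_ne_zero {ω : ℝ} (hω : ω ≠ 0) (τ : ℝ) :
    ∫ t in (0 : ℝ)..τ, Real.cos (ω * t) = Real.sin (ω * τ) / ω := by
  rw [intervalIntegral.integral_comp_mul_left (fun t => Real.cos t) hω, integral_cos]
  simp [inv_mul_eq_div]

/-- The Cesàro kernel is bounded by one: `|τ⁻¹ ∫₀^τ cos(ωt) dt| ≤ 1` for `τ > 0`. [folklore] -/
theorem norm_inv_mul_intervalIntegral_cos_mul_le {τ : ℝ} (hτ : 0 < τ) (ω : ℝ) :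
    ‖τ⁻¹ * ∫ t in (0 : ℝ)..τ, Real.cos (ω * t)‖ ≤ 1 := by
  have h1 : ‖∫ t in (0 : ℝ)..τ, Real.cos (ω * t)‖ ≤ 1 * |τ - 0| :=
    intervalIntegral.norm_integral_le_of_norm_le_const fun t _ => by
      simpa using Real.abs_cos_le_one (ω * t)
  rw [sub_zero, one_mul, abs_of_pos hτ] at h1
  rw [norm_mul, norm_inv, Real.norm_eq_abs, abs_of_pos hτ]
  calc τ⁻¹ * ‖∫ t in (0 : ℝ)..τ, Real.cos (ω * t)‖ ≤ τ⁻¹ * τ := by gcongr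
    _ = 1 := inv_mul_cancel₀ hτ.ne'

/-- The Cesàro kernel tends to the indicator of `{0}`: `τ⁻¹ ∫₀^τ cos(ωt) dt → 𝟙_{ω = 0}` as
`τ → ∞` (`= 1` at `ω = 0`, `= sin(ωτ)/(ωτ) → 0` otherwise). [folklore] -/
theorem tendsto_inv_mul_intervalIntegral_cos_mul (ω : ℝ) :
    Tendsto (fun τ : ℝ => τ⁻¹ * ∫ t in (0 : ℝ)..τ, Real.cos (ω * t)) atTop
      (𝓝 (({0} : Set ℝ).indicator 1 ω)) := by
  rcases eq_or_ne ω 0 with rfl | hω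
  · simp only [zero_mul, Real.cos_zero, intervalIntegral.integral_const, sub_zero, smul_eq_mul,
      mul_one, mem_singleton_iff, indicator_of_mem, Pi.one_apply]
    refine tendsto_const_nhds.congr' ?_
    filter_upwards [eventually_ne_atTop (0 : ℝ)] with τ hτ
    exact (inv_mul_cancel₀ hτ).symm
  · rw [indicator_of_notMem (by simpa using hω)]
    simp_rw [intervalIntegral_cos_mul_of_ne_zero hω]
    refine squeeze_zero_norm' (a := fun τ : ℝ => |ω|⁻¹ * τ⁻¹) ?_ ?_
    · filter_upwards [eventually_gt_atTop (0 : ℝ)] with τ hτ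
      rw [norm_mul, norm_inv, norm_div, Real.norm_eq_abs, Real.norm_eq_abs, Real.norm_eq_abs,
        abs_of_pos hτ]
      calc τ⁻¹ * (|Real.sin (ω * τ)| / |ω|) ≤ τ⁻¹ * (1 / |ω|) := by
            gcongr
            exact Real.abs_sin_le_one _
        _ = |ω|⁻¹ * τ⁻¹ := by ring
    · simpa using tendsto_inv_atTop_zero.const_mul |ω|⁻¹

/-- **Wiener's lemma for the atom at `0` (Cesàro form).** For a finite measure `σ` on `ℝ`,
`τ⁻¹ ∫₀^τ (∫ cos(ωt) dσ(ω)) dt → σ{0}` as `τ → ∞` (Fubini, then dominated convergence of the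
kernels `τ⁻¹ ∫₀^τ cos(ωt) dt → 𝟙_{ω=0}`, bounded by `1`). [folklore] -/
theorem tendsto_inv_mul_integral_integral_cos (σ : Measure ℝ) [IsFiniteMeasure σ] :
    Tendsto (fun τ : ℝ => τ⁻¹ * ∫ t in (0 : ℝ)..τ, ∫ ω, Real.cos (ω * t) ∂σ) atTop
      (𝓝 (σ {0}).toReal) := by
  have hker : ∀ τ : ℝ, τ⁻¹ * ∫ t in (0 : ℝ)..τ, ∫ ω, Real.cos (ω * t) ∂σ
      = ∫ ω, (τ⁻¹ * ∫ t in (0 : ℝ)..τ, Real.cos (ω * t)) ∂σ := fun τ => by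
    rw [intervalIntegral_integral_cos_mul_swap]
    exact (integral_const_mul τ⁻¹ _).symm
  have hlim : (σ {0}).toReal = ∫ ω, ({0} : Set ℝ).indicator 1 ω ∂σ := by
    rw [integral_indicator_one (measurableSet_singleton 0)]
    rfl
  have hmeas : ∀ᶠ τ : ℝ in atTop,
      AEStronglyMeasurable (fun ω : ℝ => τ⁻¹ * ∫ t in (0 : ℝ)..τ, Real.cos (ω * t)) σ := by
    refine Eventually.of_forall fun τ => Continuous.aestronglyMeasurable ?_
    exact continuous_const.mul
      (intervalIntegral.continuous_parametric_intervalIntegral_of_continuous' (by fun_prop) 0 τ)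
  have hbound : ∀ᶠ τ : ℝ in atTop,
      ∀ᵐ ω ∂σ, ‖τ⁻¹ * ∫ t in (0 : ℝ)..τ, Real.cos (ω * t)‖ ≤ (fun _ => (1 : ℝ)) ω := by
    filter_upwards [eventually_gt_atTop (0 : ℝ)] with τ hτ
    exact Eventually.of_forall fun ω => norm_inv_mul_intervalIntegral_cos_mul_le hτ ω
  have key : Tendsto (fun τ : ℝ => ∫ ω, (τ⁻¹ * ∫ t in (0 : ℝ)..τ, Real.cos (ω * t)) ∂σ) atTop
      (𝓝 (∫ ω, ({0} : Set ℝ).indicator 1 ω ∂σ)) :=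
    tendsto_integral_filter_of_dominated_convergence (fun _ => (1 : ℝ)) hmeas hbound
      (integrable_const 1) (Eventually.of_forall fun ω => tendsto_inv_mul_intervalIntegral_cos_mul ω)
  rw [hlim]
  exact key.congr fun τ => (hker τ).symm

/-! ## The abstract statement: atom at `0` of the spectral measure = ‖projection on the fixed space‖² -/

/-- **Atom at zero = squared norm of the projection onto the conserved vectors.** For a strongly
continuous contraction semigroup `U` on a real Hilbert space `E` and `x ∈ E` whose autocorrelation
is the cosine transform of a finite measure `σ`, `⟪x, U_t x⟫ = ∫ cos(ωt) dσ(ω)` (`t ≥ 0`), one has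
`σ{0} = ‖P_{Fix U} x‖²`: both sides are the limit of the Cesàro mean `τ⁻¹ ∫₀^τ ⟪U_t x, x⟫ dt`
(Wiener's lemma, resp. the von Neumann / Suzuki mean ergodic theorem
`Mazur.tendsto_inv_mul_integral_inner`). [folklore] -/
theorem measureReal_zero_eq_norm_starProjection_sq {E : Type*} [NormedAddCommGroup E]
    [InnerProductSpace ℝ E] [CompleteSpace E] {U : ℝ → E →L[ℝ] E}
    (hU : Literature.Barriers.AtomisticToContinuum.Mazur.IsContractionSemigroup U) (x : E)
    (σ : Measure ℝ) [IsFiniteMeasure σ]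
    (hC : ∀ t : ℝ, 0 ≤ t → ⟪x, U t x⟫_ℝ = ∫ ω, Real.cos (ω * t) ∂σ) :
    (σ {0}).toReal =
      ‖(Literature.Barriers.AtomisticToContinuum.Mazur.invariantSubspace U).starProjection x‖ ^ 2 := by
  have h1 := Literature.Barriers.AtomisticToContinuum.Mazur.tendsto_inv_mul_integral_inner hU x
  have h2 := tendsto_inv_mul_integral_integral_cos σ
  refine tendsto_nhds_unique (h2.congr' ?_) h1
  filter_upwards [eventually_ge_atTop (0 : ℝ)] with τ hτ
  congr 1
  refine intervalIntegral.integral_congr fun t ht => ?_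
  rw [uIcc_of_le hτ] at ht
  rw [real_inner_comm, hC t ht.1]

/-! ## The Koopman group of a `FluctuationDynamics` as a contraction semigroup -/

section FluctuationDynamics

variable {G Ω : Type*} [AddCommGroup G] [MeasurableSpace G] [MeasurableSpace Ω]
  {ν : Measure G} {T : Literature.MathematicalPhysics.KineticTheory.ShiftAction G Ω}
  [MeasurableNeg G] [ν.IsNegInvariant]

/-- A strongly continuous Koopman group `U_t = koopmanCLM t` (orthogonal operators, group law
`U_{s+t} = U_s U_t`) is in particular a strongly continuous contraction semigroup in the sense of
`Mazur.IsContractionSemigroup`. [folklore] -/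
theorem isContractionSemigroup_koopmanCLM
    (D : Literature.MathematicalPhysics.KineticTheory.FluctuationDynamics ν T)
    (hcont : D.IsStronglyContinuous) :
    Literature.Barriers.AtomisticToContinuum.Mazur.IsContractionSemigroup
      (fun t : ℝ => D.koopmanCLM t) where
  map_add s t _ _ := D.koopmanCLM_add s t
  norm_le t _ := ContinuousLinearMap.opNorm_le_bound _ zero_le_one fun ψ => by
    rw [D.norm_koopmanCLM, one_mul]
  continuous ψ := hcont ψ

/-- The conserved vectors of the Koopman group in the sense of `Mazur.invariantSubspace`
(`U_t ψ = ψ` for `t ≥ 0`) are exactly `𝒬₀ = conservedSpace` (`U_t ψ = ψ` for all `t`), by the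
group law `U_{-t} = U_t⁻¹`. [folklore] -/
theorem invariantSubspace_koopmanCLM
    (D : Literature.MathematicalPhysics.KineticTheory.FluctuationDynamics ν T) :
    Literature.Barriers.AtomisticToContinuum.Mazur.invariantSubspace (fun t : ℝ => D.koopmanCLM t)
      = D.conservedSpace := by
  ext x
  rw [Literature.Barriers.AtomisticToContinuum.Mazur.mem_invariantSubspace, D.mem_conservedSpace_iff]
  constructor
  · intro h t
    rcases le_or_gt 0 t with ht | ht
    · exact h t ht
    · have hneg : D.koopman (-t) x = x := h (-t) (neg_nonneg.mpr ht.le)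
      calc D.koopman t x = D.koopman t (D.koopman (-t) x) := by rw [hneg]
        _ = x := by rw [← D.koopman_add_apply, add_neg_cancel, D.koopman_zero_apply]
  · intro h t _
    exact h t

/-- **Atom at zero = Drude weight**, for a general `FluctuationDynamics` with strongly continuous
Koopman group: if `⟪ψ, U_t ψ⟫ = ∫ cos(ωt) dσ(ω)` for a finite measure `σ`, then
`σ{0} = 𝖣_ψ = ‖P_{𝒬₀} ψ‖²`. [folklore] -/
theorem measureReal_zero_eq_drudeWeight
    (D : Literature.MathematicalPhysics.KineticTheory.FluctuationDynamics ν T)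
    (hcont : D.IsStronglyContinuous) (ψ : D.FluctuationSpace) (σ : Measure ℝ) [IsFiniteMeasure σ]
    (hC : ∀ t : ℝ, ⟪ψ, D.koopman t ψ⟫_ℝ = ∫ ω, Real.cos (ω * t) ∂σ) :
    (σ {0}).toReal = D.drudeWeight ψ := by
  have h := measureReal_zero_eq_norm_starProjection_sq (isContractionSemigroup_koopmanCLM D hcont) ψ σ
    fun t _ => hC t
  simp only [invariantSubspace_koopmanCLM] at h
  rw [h, D.drudeWeight_def]
  rfl

end FluctuationDynamics

/-- **S2a `stub_atomEqDrudeWeightOfContinuous`** (= `Cruxes.NoDrudeWeight.Birth.stub_atomEqDrudeWeight`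
with the STRONG CONTINUITY of the Koopman group added as a hypothesis — the canonical datum used below has
it, so this weaker form suffices here; functional analysis, provable). For ANY chain `P`, dynamics `D`,
zero-wavenumber datum `Z` with strongly continuous Koopman group `U_t` on `ℋ₀`, class `ψ ∈ ℋ₀` and
finite `σ` with `⟪ψ, U_t ψ⟫₀ = ∫ cos(ωt) dσ(ω)` for all `t`: `σ{0} = 𝖣_ψ = ‖ℙ_{𝒬₀} ψ‖²` (Wiener's
lemma for the atom at `0` + von Neumann's / Suzuki's mean ergodic theorem, in tree as
`Literature.Barriers.AtomisticToContinuum.Mazur.tendsto_inv_mul_integral_inner`). [folklore] -/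
theorem stub_atomEqDrudeWeightOfContinuous :
    ∀ (P : Literature.MathematicalPhysics.KineticTheory.HeatConduction.OscillatorChain)
    (D : Literature.MathematicalPhysics.KineticTheory.HeatConduction.InfiniteChainDynamics P)
    (Z : Literature.MathematicalPhysics.KineticTheory.HeatConduction.ZeroWavenumberData P D),
    (∀ φ : Literature.MathematicalPhysics.KineticTheory.HeatConduction.ZeroWavenumberSpace Z,
      Continuous fun t : ℝ => Z.koopman t φ) →
    ∀ (ψ : Literature.MathematicalPhysics.KineticTheory.HeatConduction.ZeroWavenumberSpace Z)
    (σ : MeasureTheory.Measure ℝ), MeasureTheory.IsFiniteMeasure σ →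
    (∀ t : ℝ, ⟪ψ, Z.koopman t ψ⟫_ℝ = MeasureTheory.integral σ (fun ω : ℝ => Real.cos (ω * t))) →
    (σ {0}).toReal = Z.toFluctuationDynamics.drudeWeight ψ := by
  intro P D Z hcont ψ σ hσ hC
  exact measureReal_zero_eq_drudeWeight Z.toFluctuationDynamics hcont ψ σ hC

end Summit.AtomisticToContinuum.FouriersLaw.Theorems.GreenKuboContinuation.SpectralTrichotomy

end
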